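import Summits.ResolutionOfSingularities.ResolutionOfSingularities.Theorems.FrobeniusClosingPatchingRelPerfectCuspLineStepGlue
import Summits.ResolutionOfSingularities.ResolutionOfSingularities.Theorems.FrobeniusClosingPatchingRelPerfectChartPrincipal
import Summits.ResolutionOfSingularities.ResolutionOfSingularities.Theorems.FrobeniusClosingPatchingRelPerfectPairSwap
import HarnessLib

/-!
# Crux `PatchingRelPerfect` (stmt-ResolutionOfSingularities-16161), chain W5.2 — the CROSSING-LINES
# member `I = (x₀x₁ + x₂x₃, x₃²) + 𝔪⁴`, part 1: PERSISTENCE TOOLS (ring level, any ring)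

[OURS · L1 W5.2 · kernel certificate, res-L1-w52-plan-1 NAMING 2026-08-27T17:00:47Z (O2′)]
The crossing-lines member is the first member of the `𝔪`-primary stratum of the open core whose
hand tower blows up centres which are NOT cut out by chart generators of the previous centre:
on the chart of `x₂` of `Bl_𝔪` the cosupport of the residual is the union of the two LINES
`L₀ ∪ L₁ ⊂ E` crossing at the origin, and the tower is `𝔪 → L₀ → S₁ → L₁″ → S₂` (`S₁`, `S₂`
surfaces inside the newest exceptional divisor, `L₁″` the strict transform of `L₁`, which is
TRANSVERSAL to the exceptional divisor of `S₁`).  To carry regular-sequence hypotheses through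
such a tower one needs, besides the strict transform of a coordinate sub-family
(`ChartStrictTransform.exists_strictTransformHom`, p512186), the case where the reduced family is
a SINGLE non-zero-divisor, so that its chart is the base itself.  THIS FILE (tools only):

* `CrossingLines.chartBase_bijective_fin_one` — the Rees chart of a principal ideal generated by
  a non-zero-divisor is the base (any `Fin 1`-family; `ChartPrincipal` p531731 for `![g]`);
* `CrossingLines.exists_quotEquiv_single` — **`B ⧸ (e_J) ≅ R ⧸ (x_J)`** with `r/1 ↦ r̄` when the
  complement of `J` is one index `i` and `x̄_i` is a non-zero-divisor of `R/(x_J)`;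
  `exists_quotSupEquiv_single` — hence `B ⧸ ((e_J) + L B) ≅ R ⧸ ((x_J) + L)` for every ideal
  `L ≤ R`, with the two transports used by the tower: `isRegularRing_quot_sup_map_single`
  (regularity of the quotient) and `mk_chartBase_mem_nonZeroDivisors_sup_single`
  (non-zero-divisors modulo `(x_J) + L` stay non-zero-divisors modulo `(e_J) + L B`);
* `CrossingLines.forall_mem_sup_exchange` — the EXCHANGE LEMMA: if `b` is regular modulo `U` and
  `w` is regular modulo `U + (b)` then `b` is regular modulo `U + (w)`;
* two-term glue (`isWeaklyRegular_two`, `nzd_of_isWeaklyRegular_two`,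
  `forall_mem_of_isWeaklyRegular_two`, `isQuasiRegular_two`).

Arbitrary commutative rings; fact-free; nothing here is a statement of the manuscript under
review (AI-written; AI review weaker than expert review).

## References

* U. Görtz, T. Wedhorn, *Algebraic Geometry I* (2nd ed., 2020), Prop. 13.96 (2), p. 416;
  Prop. 13.91 (4). [GortzWedhorn2020]
* The Stacks Project, Tags 0804, 0BIQ, 052Q. [StacksProject]
* H. Matsumura, *Commutative Ring Theory*, CUP 1986, Thm. 16.2 (i). [Matsumura1987]
-/

-- `Summit.<Summit>.<Sub>.Theorems` with `Sub = Summit` (single-conjunct summit, D-0017)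
set_option linter.dupNamespace false

noncomputable section

open CategoryTheory CategoryTheory.Limits AlgebraicGeometry Literature.AlgebraicGeometry.Resolution
open scoped Pointwise nonZeroDivisors

namespace Summit.ResolutionOfSingularities.ResolutionOfSingularities.Theorems

universe u

namespace CrossingLines

open CuspMember

/-! ## Two-term glue and the exchange lemma -/

section Glue

variable {A : Type u} [CommRing A]

omit [CommRing A] in
/-- `List.ofFn (Fin.cons p (fun _ => q)) = [p, q]`. [folklore] -/
theorem ofFn_cons_one (p q : A) : List.ofFn (Fin.cons p fun _ : Fin 1 => q) = [p, q] := rfl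

/-- A two-term sequence `(p, q)` is weakly regular if `p` is a non-zero-divisor and `q` is regular
modulo `(p)`. [cite: Matsumura1987, Thm. 16.2 (i)] -/
theorem isWeaklyRegular_two {p q : A} (hp : p ∈ A⁰)
    (hq : ∀ g, q * g ∈ Ideal.span {p} → g ∈ Ideal.span {p}) :
    RingTheory.Sequence.IsWeaklyRegular A [p, q] := by
  rw [← ofFn_cons_one, ConeRung.isWeaklyRegular_pair_iff]
  exact ⟨Module.Flat.isSMulRegular_of_nonZeroDivisors hp, (ConeRung.isSMulRegular_quot_span_iff p q).mpr hq⟩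

/-- From `(p, q)` weakly regular: `p` is a non-zero-divisor. [folklore] -/
theorem nzd_of_isWeaklyRegular_two {p q : A} (h : RingTheory.Sequence.IsWeaklyRegular A [p, q]) : p ∈ A⁰ := by
  rw [← ofFn_cons_one, ConeRung.isWeaklyRegular_pair_iff] at h
  exact mem_nonZeroDivisors_of_isSMulRegular h.1

/-- From `(p, q)` weakly regular: `q` is regular modulo `(p)`. [folklore] -/
theorem forall_mem_of_isWeaklyRegular_two {p q : A} (h : RingTheory.Sequence.IsWeaklyRegular A [p, q]) :
    ∀ g, q * g ∈ Ideal.span {p} → g ∈ Ideal.span {p} := by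
  rw [← ofFn_cons_one, ConeRung.isWeaklyRegular_pair_iff] at h
  exact (ConeRung.isSMulRegular_quot_span_iff p q).mp h.2

/-- From `(p, q)` weakly regular: `(p, q)` is quasi-regular. [cite: Matsumura1987, Thm. 16.2 (i)] -/
theorem isQuasiRegular_two {p q : A} (h : RingTheory.Sequence.IsWeaklyRegular A [p, q]) :
    IsQuasiRegular ![p, q] :=
  isQuasiRegular_of_isWeaklyRegular _ (by rw [ofFn_vec2]; exact h)

/-- From `(p, q)` weakly regular with `q` a non-zero-divisor: `(q, p)` is weakly regular.
[cite: Matsumura1987, Thm. 16.2 (i)] -/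
theorem isWeaklyRegular_two_swap {p q : A} (h : RingTheory.Sequence.IsWeaklyRegular A [p, q])
    (hq : q ∈ A⁰) : RingTheory.Sequence.IsWeaklyRegular A [q, p] := by
  have h' := ConeRung.isWeaklyRegular_pair_swap p q (nzd_of_isWeaklyRegular_two h) hq
    (by rw [ofFn_cons_one]; exact h)
  rwa [ofFn_cons_one] at h'

/-- **Exchange lemma.** If `b` is regular modulo the ideal `U` and `w` is regular modulo
`U + (b)`, then `b` is regular modulo `U + (w)`: from `b g = x + h w` one gets
`w h ∈ U + (b)`, so `h = y + h' b` with `y ∈ U`, whence `b (g - h' w) = x + y w ∈ U`,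
`g - h' w ∈ U`. [folklore] -/
theorem forall_mem_sup_exchange {U : Ideal A} {b w : A}
    (hb : ∀ g, b * g ∈ U → g ∈ U)
    (hw : ∀ g, w * g ∈ U ⊔ Ideal.span {b} → g ∈ U ⊔ Ideal.span {b}) :
    ∀ g, b * g ∈ U ⊔ Ideal.span {w} → g ∈ U ⊔ Ideal.span {w} := by
  intro g hg
  obtain ⟨x, hx, y, hy, hxy⟩ := Submodule.mem_sup.mp hg
  obtain ⟨h, rfl⟩ := Ideal.mem_span_singleton'.mp hy
  -- `w h = b g - x ∈ U + (b)`
  have hwh : w * h ∈ U ⊔ Ideal.span {b} := by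
    have e : w * h = b * g - x := by rw [← hxy]; ring
    rw [e]
    exact Ideal.sub_mem _ (Ideal.mem_sup_right (Ideal.mem_span_singleton'.mpr ⟨g, mul_comm g b⟩))
      (Ideal.mem_sup_left hx)
  obtain ⟨y', hy', z, hz, hyz⟩ := Submodule.mem_sup.mp (hw h hwh)
  obtain ⟨h', rfl⟩ := Ideal.mem_span_singleton'.mp hz
  -- `b (g - h' w) = x + y' w ∈ U`
  have hkey : b * (g - h' * w) ∈ U := by
    have e : b * (g - h' * w) = x + y' * w := by
      have e1 : b * g = x + (y' + h' * b) * w := by rw [hyz, hxy]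
      linear_combination e1
    rw [e]
    exact Ideal.add_mem _ hx (Ideal.mul_mem_right _ _ hy')
  have hg' := hb _ hkey
  have e : g = (g - h' * w) + h' * w := by ring
  rw [e]
  exact Ideal.add_mem _ (Ideal.mem_sup_left hg') (Ideal.mem_sup_right (Ideal.mem_span_singleton'.mpr ⟨h', rfl⟩))

end Glue

/-! ## The Rees chart of a principal ideal (any `Fin 1`-family) -/

section Principal

variable {R : Type u} [CommRing R]

omit [CommRing R] in
/-- A `Fin 1`-family is the one-member family of its value. [folklore] -/
theorem fin_one_eq_vec (y : Fin 1 → R) : y = ![y 0] := by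
  funext k
  fin_cases k
  rfl

/-- **The Rees chart of a principal ideal generated by a non-zero-divisor is the base ring**
(any `Fin 1`-family): the structure map `r ↦ r/1` is bijective.
[cite: StacksProject, Tag 0804] [cite: StacksProject, Tag 052Q] -/
theorem chartBase_bijective_fin_one (y : Fin 1 → R) (hy : y 0 ∈ R⁰) :
    Function.Bijective (chartBase y 0) := by
  rw [fin_one_eq_vec y]
  exact ChartPrincipal.chartBase_bijective_of_singleton (y 0) hy

end Principal

/-! ## The quotient of a Rees chart by the chart generators of a sub-family whose complement is
ONE index carrying a non-zero-divisor of the reduced ring -/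

section Single

variable {R : Type u} [CommRing R] {n a : ℕ} (x : Fin n → R) (emb : Fin 1 → Fin n)
  (jJ : Fin a → {j : Fin n // j ≠ emb 0})

/-- The ideal `(x_j : j ∈ J)` downstairs. -/
local notation3 "Q" => Ideal.span (Set.range fun k : Fin a => x (jJ k).1)
/-- The reduced one-member family `(x̄_i)` over `R/(x_J)`. -/
local notation3 "xb" => (fun k : Fin 1 => Ideal.Quotient.mk
  (Ideal.span (Set.range fun k : Fin a => x (jJ k).1)) (x (emb k)))
/-- The ideal `(e_j : j ∈ J)` of the strict transform on the chart of `x_i`. -/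
local notation3 "EJ" => Ideal.span (Set.range fun k : Fin a => chartGen x (emb 0) (jJ k).1)
/-- The chart map. -/
local notation3 "φ" => chartBase x (emb 0)

/-- **`B ⧸ (e_J) ≅ R ⧸ (x_J)`, `r/1 ↦ r̄`**, when the complement of `J` is the single chart index
`i` and `x̄_i` is a non-zero-divisor of `R/(x_J)`: the strict transform of `V(x_J)` on the chart
is the Rees chart of the principal ideal `(x̄_i)` over `R/(x_J)` (GW Prop. 13.96 (2),
`ChartStrictTransform.exists_strictTransformHom`), which is `R/(x_J)` itself.
[cite: GortzWedhorn2020, Prop. 13.96 (2), p. 416] [cite: StacksProject, Tag 0804] -/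
theorem exists_quotEquiv_single (hx : IsQuasiRegular x) (hjJ : Function.Injective jJ)
    (hcov : ∀ j : Fin n, (∃ k, emb k = j) ∨ ∃ k, (jJ k).1 = j)
    (hnz : Ideal.Quotient.mk Q (x (emb 0)) ∈ (R ⧸ Q)⁰) :
    ∃ Ψ : (chartRing x (emb 0) ⧸ EJ) ≃+* R ⧸ Q,
      ∀ r : R, Ψ (Ideal.Quotient.mk EJ (φ r)) = Ideal.Quotient.mk Q r := by
  obtain ⟨Θ, hΘ, hΘbase, -⟩ := ChartStrictTransform.exists_strictTransformHom x emb 0 jJ hx hjJ hcov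
  have hβ : Function.Bijective (chartBase xb 0) := chartBase_bijective_fin_one xb hnz
  refine ⟨(RingEquiv.ofBijective Θ hΘ).trans (RingEquiv.ofBijective (chartBase xb 0) hβ).symm, fun r => ?_⟩
  rw [RingEquiv.trans_apply, RingEquiv.symm_apply_eq, RingEquiv.ofBijective_apply, RingEquiv.ofBijective_apply]
  exact hΘbase r

/-- **`B ⧸ ((e_J) + L·B) ≅ R ⧸ ((x_J) + L)`, `r/1 ↦ r̄`**, for every ideal `L ≤ R`, under the
hypotheses of `exists_quotEquiv_single`. [cite: GortzWedhorn2020, Prop. 13.96 (2), p. 416] -/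
theorem exists_quotSupEquiv_single (hx : IsQuasiRegular x) (hjJ : Function.Injective jJ)
    (hcov : ∀ j : Fin n, (∃ k, emb k = j) ∨ ∃ k, (jJ k).1 = j)
    (hnz : Ideal.Quotient.mk Q (x (emb 0)) ∈ (R ⧸ Q)⁰) (L : Ideal R) :
    ∃ Φ : (chartRing x (emb 0) ⧸ (EJ ⊔ L.map φ)) ≃+* R ⧸ (Q ⊔ L),
      ∀ r : R, Φ (Ideal.Quotient.mk (EJ ⊔ L.map φ) (φ r)) = Ideal.Quotient.mk (Q ⊔ L) r := by
  obtain ⟨Ψ, hΨ⟩ := exists_quotEquiv_single x emb jJ hx hjJ hcov hnz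
  have hcomp : ((Ψ : (chartRing x (emb 0) ⧸ EJ) →+* R ⧸ Q).comp (Ideal.Quotient.mk EJ)).comp φ =
      Ideal.Quotient.mk Q :=
    RingHom.ext fun r => by
      rw [RingHom.comp_apply, RingHom.comp_apply, RingHom.coe_coe]
      exact hΨ r
  have hIJ : L.map (Ideal.Quotient.mk Q) =
      ((L.map φ).map (Ideal.Quotient.mk EJ)).map (Ψ : (chartRing x (emb 0) ⧸ EJ) →+* R ⧸ Q) := by
    rw [Ideal.map_map, Ideal.map_map, hcomp]
  let e1 := (DoubleQuot.quotQuotEquivQuotSup EJ (L.map φ)).symm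
  let e2 := Ideal.quotientEquiv _ _ Ψ hIJ
  let e3 := DoubleQuot.quotQuotEquivQuotSup Q L
  refine ⟨e1.trans (e2.trans e3), fun r => ?_⟩
  rw [RingEquiv.trans_apply, RingEquiv.trans_apply]
  have h1 : e1 (Ideal.Quotient.mk (EJ ⊔ L.map φ) (φ r)) =
      Ideal.Quotient.mk _ (Ideal.Quotient.mk EJ (φ r)) :=
    DoubleQuot.quotQuotEquivQuotSup_symm_quotQuotMk EJ (L.map φ) (φ r)
  have h2 : e2 (Ideal.Quotient.mk _ (Ideal.Quotient.mk EJ (φ r))) =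
      Ideal.Quotient.mk _ (Ψ (Ideal.Quotient.mk EJ (φ r))) :=
    Ideal.quotientEquiv_mk _ _ Ψ hIJ _
  rw [h1, h2, hΨ]
  exact DoubleQuot.quotQuotEquivQuotSup_quotQuotMk Q L r

/-- **Regularity transport**: `B ⧸ ((e_J) + L·B)` is a regular ring when `R ⧸ ((x_J) + L)` is.
[cite: GortzWedhorn2020, Prop. 13.96 (2), p. 416] -/
theorem isRegularRing_quot_sup_map_single (hx : IsQuasiRegular x) (hjJ : Function.Injective jJ)
    (hcov : ∀ j : Fin n, (∃ k, emb k = j) ∨ ∃ k, (jJ k).1 = j)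
    (hnz : Ideal.Quotient.mk Q (x (emb 0)) ∈ (R ⧸ Q)⁰) (L : Ideal R)
    (hreg : IsRegularRing (R ⧸ (Q ⊔ L))) :
    IsRegularRing (chartRing x (emb 0) ⧸ (EJ ⊔ L.map φ)) := by
  obtain ⟨Φ, -⟩ := exists_quotSupEquiv_single x emb jJ hx hjJ hcov hnz L
  haveI := hreg
  exact IsRegularRing.of_ringEquiv Φ.symm

/-- **Non-zero-divisor transport**: if `r̄` is a non-zero-divisor of `R ⧸ ((x_J) + L)` then
`r/1` is a non-zero-divisor of `B ⧸ ((e_J) + L·B)`. [cite: GortzWedhorn2020, Prop. 13.91 (4) (proof)] -/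
theorem mk_chartBase_mem_nonZeroDivisors_sup_single (hx : IsQuasiRegular x)
    (hjJ : Function.Injective jJ) (hcov : ∀ j : Fin n, (∃ k, emb k = j) ∨ ∃ k, (jJ k).1 = j)
    (hnz : Ideal.Quotient.mk Q (x (emb 0)) ∈ (R ⧸ Q)⁰) (L : Ideal R) {r : R}
    (hr : Ideal.Quotient.mk (Q ⊔ L) r ∈ (R ⧸ (Q ⊔ L))⁰) :
    Ideal.Quotient.mk (EJ ⊔ L.map φ) (φ r) ∈ (chartRing x (emb 0) ⧸ (EJ ⊔ L.map φ))⁰ := by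
  obtain ⟨Φ, hΦ⟩ := exists_quotSupEquiv_single x emb jJ hx hjJ hcov hnz L
  refine mem_nonZeroDivisors_of_injective (f := (Φ : _ →+* R ⧸ (Q ⊔ L))) Φ.injective ?_
  rw [RingHom.coe_coe, hΦ]
  exact hr

end Single

end CrossingLines

end Summit.ResolutionOfSingularities.ResolutionOfSingularities.Theorems

end
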